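import Summits.Ventures.QEC.Census.CertCoverBatch
import Summits.Ventures.QEC.Census.TwoBGA.TB_l6m24_A0_0_0_1_3_11_B0_0_1_11_5_4.CoreDefs
import HarnessLib

set_option Elab.async false
set_option maxRecDepth 200000

/-!
# `[[288,12,16]]` one-level cover certificate of `TB_l6m24_A0_0_0_1_3_11_B0_0_1_11_5_4` — LEVEL-1→0 coset problems 17…26 (deep problems [5] excluded: `ProbDeep*.lean`) as COMPACT data
(`ProbData`: U, f, σ, y₀, allow; qec-type-10 `CertCoverBatch.mkCoset` rebuilds each `CosetProb` in the kernel) + their verdict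
`probsOK cov covR hx hx1 D1 lxd 14` (one `decide +kernel`; 10 problems, depths f=0:3 f=1:7 f=2:0 f=3:0, est. 66.5 s).
qec-search-1 g5 (pattern of search-9 g5 `Probs*`); data from JSON `level10.problems` (sha256 fee0559d1bce5e88…). Data + decided check; KERNEL.
-/

namespace Summit.Ventures.QEC.Census.TB_l6m24_A0_0_0_1_3_11_B0_0_1_11_5_4

open Matrix Summit.Ventures.QEC.Census Literature.InformationTheory.QuantumCodes

/-- Problems 17…26 (10): `⟨U, f, σ, y₀, allow⟩`. -/
def probs02 : List ProbData := [
    ⟨4218741212142216876665299622430720, 1, 864691128857788432, 4218741212066658436478632727152640, [0]⟩,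
    ⟨5516815421907183107278921068969993, 0, 30192133138956683268, 5516815421864681664817906119081984, [0]⟩,
    ⟨5516815426757052188149216514148360, 1, 27670117210088538112, 5192296858534846075274570047160320, [0]⟩,
    ⟨8112963856118894885610358890301440, 1, 805314592, 8112963855967779158158529706592256, [0]⟩,
    ⟨10709112285348566661218222287099920, 1, 55340797370105331712, 10709112285235229865629350801967104, [0]⟩,
    ⟨15901409144072252056140507056179200, 1, 1610629184, 302231454903658367418368, [0]⟩,
    ⟨21093706002531595607356233849776160, 1, 110681594740210663424, 226673591177742970265632, [0]⟩,
    ⟨1329552544102328274843868795020771328, 0, 442721857906468203520, 324518606851459090653661106798592, [0]⟩,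
    ⟨1329552573769391206168133130035134464, 0, 2522015928868145156, 1329228055206061370578589793963212800, [0]⟩,
    ⟨1329552573774203296317140468318603265, 1, 0, 0, [0]⟩]

set_option maxHeartbeats 400000000 in
/-- Every problem of this chunk passes (`mkCoset` elimination + `cosetOKD` + fast `σ` + depth + `BU`-evenness + label checks). -/
theorem probs02_ok : probsOK TB_l6m24_A0_0_0_1_3_11_B0_0_1_11_5_4.cov covR hx hx1 D1 lxd 14 probs02 = true := by
  decide +kernel

/-- Pointwise form. -/
theorem probs02_all : ∀ x ∈ TB_l6m24_A0_0_0_1_3_11_B0_0_1_11_5_4.probs02, probOK cov covR hx hx1 D1 lxd 14 x = true := by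
  have h := probs02_ok
  rwa [probsOK, List.all_eq_true] at h

end Summit.Ventures.QEC.Census.TB_l6m24_A0_0_0_1_3_11_B0_0_1_11_5_4
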